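import Mathlib.RingTheory.Derivation.Basic
import Mathlib.RingTheory.Ideal.Operations
import Mathlib.RingTheory.Ideal.Prime
import Mathlib.RingTheory.Ideal.BigOperators
import Mathlib.Algebra.Algebra.Basic
import Mathlib.Algebra.BigOperators.Fin
import Mathlib.Data.Nat.Factorial.Basic
import Mathlib.LinearAlgebra.FiniteDimensional.Basic
import Mathlib.LinearAlgebra.Dimension.Finite
import HarnessLib

/-!
# Wüstholz's multiplicity lemma (algebraic core) for commuting derivations of a commutative algebra

Topic: `Literature/NumberTheory/Transcendental`. A brick towards the discharge of the named fact
`philippon1986_std` (`PhilipponZeroEstimateStd.lean`: Philippon's zero estimate, Thm. 2.1, on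
the group varieties `M_κ = 𝔾ₘ^β × P_κ` in the theta embedding). The heart of the multiplicity
part of D. Roy's proof (Nesterenko–Philippon (eds.), LNM 1752, Ch. 11, **Prop. 3.8, Step 3**,
pp. 217–218; Philippon 1986, Prop. 4.7 "Wüstholz") is pure commutative algebra: commuting
derivations `∂^{e_1}, …, ∂^{e_s}` of a ring of functions, a prime `𝔭` (the ideal of a translate
`σ + H` of an algebraic subgroup), local equations `g₁, …, g_s ∈ 𝔭` with
`∂^{e_i} g_j ≡ δ_{ij}·(unit) (mod 𝔭)` (Step 2), and an ideal `𝔮` with `∂^μ 𝔮 ⊆ 𝔭` for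
`|μ| ≤ T`; then the products `f_i g^κ`, `|κ| ≤ T`, of functions `f_i` linearly independent
modulo `𝔭` are linearly independent modulo `𝔮` ((96)–(97)), whence
`H(𝔮; D + dT) ≥ binom(T+s, s) H(𝔭; D)` ((95)).

The tree proves this for `G = 𝔾ₐ × 𝔾ₘⁿ`, where the ring is the polynomial ring
`ℂ[X, Y₁, …, Y_n]` and the derivations are the explicit invariant derivations `GaGm.invDeriv`
(`PhilipponZeroEstimateMultiplicity.lean`, `PhilipponZeroEstimateIndependence.lean`, namespace
`GaGm`, all statements over `MvPolynomial (Fin (n+1)) ℂ`). For the theta model of `M_κ` the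
rings in which Roy's §3 takes place are not polynomial rings (quotients `ℂ[X_J]/𝔊` of the
homogeneous coordinate ring, their localisations at the charts `{Θ_{J₀} ≠ 0}`, rings of regular
functions on open sets), so this file PROVES the same statements **for an arbitrary commutative
algebra `R` over a field `k` of characteristic `0` and an arbitrary finite family of pairwise
commuting `k`-derivations `D₁, …, D_s` of `R`** — the proofs are those of the `GaGm` files,
verbatim up to the generality (TODO(dedup): derive the `GaGm` statements from these by
`D i = GaGm.invDeriv (w i)`):

* `opPow D μ` — the monomial `D^μ = D₁^{μ₁} ∘ ⋯ ∘ D_s^{μ_s}`; linearity, `opPow_comm`,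
  peeling a letter `opPow_sub_single` (uses the commutation);
* **Lemma A** `derivation_mem_pow_pred`, `opPow_mem_pow_sub`: `D(𝔭^{N+1}) ⊆ 𝔭^N`,
  `D^μ(𝔭^N) ⊆ 𝔭^{N-|μ|}` (any ideal `𝔭`);
* **Lemma B** `opPow_mul_gpow_sub_mem`: for `gᵢ ∈ 𝔭`, `Dᵢ g_j ∈ 𝔭 (i ≠ j)` and `|κ| ≥ |μ|`,
  `D^μ(a g^κ) ≡ [κ = μ]·u_μ·a (mod 𝔭)` with the unit `u_μ = ∏ μᵢ! (Dᵢgᵢ)^{μᵢ} ∉ 𝔭`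
  (`lemmaBUnit_notMem`, `𝔭` prime, `Dᵢgᵢ ∉ 𝔭`, `char k = 0`);
* **Step 3** `coeff_eq_zero_of_sum_mem`: the `F_l g^κ`, `κ` in a finite set of multi-indices of
  order `≤ T`, are linearly independent modulo `𝔮` when the `F_l` are modulo `𝔭`;
* **the count** `card_mul_finrank_quotient_le` ((95) in filtration-free form): for
  finite-dimensional `k`-subspaces `V, W ≤ R` with `V·g^κ ⊆ W` (`κ ∈ K`),
  `#K · dim_k(V/V ∩ 𝔭) ≤ dim_k(W/W ∩ 𝔮)`.

No definitions of mathematical content beyond `opPow`, `order`, `gpow`, `lemmaBUnit`; no named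
facts.

## References

* Yu. V. Nesterenko, P. Philippon (eds.), *Introduction to Algebraic Independence Theory*,
  LNM 1752, Springer 2001, Ch. 11 (D. Roy), Prop. 3.8, Steps 2–3, (95)–(97) (pp. 216–218).
* P. Philippon, *Lemmes de zéros dans les groupes algébriques commutatifs*, Bull. Soc. Math.
  France 114 (1986), 355–383, Lemme 4.6, Prop. 4.7.
* G. Wüstholz, *Multiplicity estimates on group varieties*, Ann. of Math. 129 (1989), 471–500, §3.
-/

namespace Literature.NumberTheory.Transcendental

namespace MultiplicityLemma

variable {k : Type*} [Field k] {R : Type*} [CommRing R] [Algebra k R]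

/-! ### Monomials in commuting derivations -/

/-- `D^μ = D₀^{μ₀} ∘ D₁^{μ₁} ∘ ⋯ ∘ D_{s-1}^{μ_{s-1}}` applied to `f`, for a family
`D = (D₀, …, D_{s-1})` of derivations. [folklore] -/
def opPow : {s : ℕ} → (Fin s → Derivation k R R) → (Fin s → ℕ) → R → R
  | 0, _, _, f => f
  | _ + 1, D, μ, f => (D 0)^[μ 0] (opPow (Fin.tail D) (Fin.tail μ) f)

/-- `D^μ` for `s = 0` is the identity. [folklore] -/
@[simp] theorem opPow_zero (D : Fin 0 → Derivation k R R) (μ : Fin 0 → ℕ) (f : R) : opPow D μ f = f := rfl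

/-- Recursion of `D^μ`. [folklore] -/
theorem opPow_succ {s : ℕ} (D : Fin (s + 1) → Derivation k R R) (μ : Fin (s + 1) → ℕ) (f : R) :
    opPow D μ f = (D 0)^[μ 0] (opPow (Fin.tail D) (Fin.tail μ) f) := rfl

/-- Iterates of a derivation commuting with `E` commute with `E`. [folklore] -/
theorem iterate_comm_of_comm (A : Derivation k R R) (E : R → R) (h : ∀ f, A (E f) = E (A f)) (n : ℕ)
    (f : R) : A^[n] (E f) = E (A^[n] f) := by
  induction n generalizing f with
  | zero => rfl
  | succ n ih => rw [Function.iterate_succ_apply, Function.iterate_succ_apply, h, ih]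

/-- Iterates of a derivation are additive. [folklore] -/
theorem iterate_add (A : Derivation k R R) (n : ℕ) (f g : R) : A^[n] (f + g) = A^[n] f + A^[n] g := by
  induction n generalizing f g with
  | zero => rfl
  | succ n ih => rw [Function.iterate_succ_apply, Function.iterate_succ_apply,
      Function.iterate_succ_apply, map_add, ih]

/-- Iterates of a derivation are `k`-homogeneous. [folklore] -/
theorem iterate_smul (A : Derivation k R R) (n : ℕ) (c : k) (f : R) : A^[n] (c • f) = c • A^[n] f := by
  induction n generalizing f with
  | zero => rfl
  | succ n ih => rw [Function.iterate_succ_apply, Function.iterate_succ_apply, Derivation.map_smul, ih]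

/-- `D^μ` commutes with every map commuting with all the `Dᵢ`. [folklore] -/
theorem opPow_comm {s : ℕ} (D : Fin s → Derivation k R R) (μ : Fin s → ℕ) (E : R → R)
    (h : ∀ i f, D i (E f) = E (D i f)) (f : R) : opPow D μ (E f) = E (opPow D μ f) := by
  induction s generalizing f with
  | zero => rfl
  | succ s ih =>
    rw [opPow_succ, opPow_succ, ih (Fin.tail D) (Fin.tail μ) (fun i => h i.succ),
      iterate_comm_of_comm _ _ (h 0)]

/-- `D^μ` is additive. [folklore] -/
theorem opPow_add {s : ℕ} (D : Fin s → Derivation k R R) (μ : Fin s → ℕ) (f g : R) :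
    opPow D μ (f + g) = opPow D μ f + opPow D μ g := by
  induction s generalizing f g with
  | zero => rfl
  | succ s ih => rw [opPow_succ, opPow_succ, opPow_succ, ih, iterate_add]

/-- `D^μ` is `k`-homogeneous. [folklore] -/
theorem opPow_smul {s : ℕ} (D : Fin s → Derivation k R R) (μ : Fin s → ℕ) (c : k) (f : R) :
    opPow D μ (c • f) = c • opPow D μ f := by
  induction s generalizing f with
  | zero => rfl
  | succ s ih => rw [opPow_succ, opPow_succ, ih, iterate_smul]

/-- `D^μ 0 = 0`. [folklore] -/
theorem opPow_map_zero {s : ℕ} (D : Fin s → Derivation k R R) (μ : Fin s → ℕ) : opPow D μ 0 = 0 := by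
  have := opPow_smul D μ 0 (0 : R)
  simpa using this

/-- `D^0 = id`. [folklore] -/
theorem opPow_zero_exponent {s : ℕ} (D : Fin s → Derivation k R R) (f : R) : opPow D 0 f = f := by
  induction s generalizing f with
  | zero => rfl
  | succ s ih => rw [opPow_succ]; exact ih _ f

/-- `D^μ` of a finite sum. [folklore] -/
theorem opPow_sum {s : ℕ} (D : Fin s → Derivation k R R) (μ : Fin s → ℕ) {ι : Type*} (t : Finset ι)
    (f : ι → R) : opPow D μ (∑ i ∈ t, f i) = ∑ i ∈ t, opPow D μ (f i) := by
  classical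
  induction t using Finset.induction_on with
  | empty => simp only [Finset.sum_empty]; exact opPow_map_zero D μ
  | insert a t ha ih => rw [Finset.sum_insert ha, Finset.sum_insert ha, opPow_add, ih]

/-- **Peeling a letter**: for pairwise commuting `Dᵢ`, if `μᵢ > 0` then
`D^μ f = D^{μ - eᵢ}(Dᵢ f)`. [folklore] -/
theorem opPow_sub_single {s : ℕ} (D : Fin s → Derivation k R R)
    (hD : ∀ i j (f : R), D i (D j f) = D j (D i f)) (μ : Fin s → ℕ) (i : Fin s)
    (hi : 0 < μ i) (f : R) : opPow D μ f = opPow D (μ - Pi.single i 1) (D i f) := by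
  induction s generalizing f with
  | zero => exact i.elim0
  | succ s ih =>
    rw [opPow_succ, opPow_succ]
    refine Fin.cases ?_ (fun i' => ?_) i hi
    · -- peel from the outermost block
      intro h0
      have htail : Fin.tail (μ - Pi.single (0 : Fin (s + 1)) 1) = Fin.tail μ := by
        funext j
        simp [Fin.tail, Pi.sub_apply, Fin.succ_ne_zero]
      rw [htail, Pi.sub_apply, Pi.single_eq_same]
      obtain ⟨m, hm⟩ : ∃ m, μ 0 = m + 1 := ⟨μ 0 - 1, by omega⟩
      rw [hm, Nat.add_sub_cancel, Function.iterate_succ_apply,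
        ← opPow_comm (Fin.tail D) (Fin.tail μ) (D 0) (fun j g => hD j.succ 0 g)]
    · -- peel inside the tail
      intro hi'
      have h0 : (μ - Pi.single i'.succ 1 : Fin (s + 1) → ℕ) 0 = μ 0 := by
        rw [Pi.sub_apply, Pi.single_apply, if_neg (Fin.succ_ne_zero i').symm, Nat.sub_zero]
      have htail : Fin.tail (μ - Pi.single i'.succ 1) = Fin.tail μ - Pi.single i' 1 := by
        funext j
        simp only [Fin.tail, Pi.sub_apply, Pi.single_apply, Fin.succ_inj]
      rw [h0, htail, ih (Fin.tail D) (fun a b g => hD a.succ b.succ g) (Fin.tail μ) i' hi']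
      rfl

/-! ### Lemma A: derivations and powers of an ideal -/

/-- **Lemma A**: a derivation maps `𝔭^{N+1}` into `𝔭^N`. [folklore] -/
theorem derivation_mem_pow_pred (A : Derivation k R R) (𝔭 : Ideal R) :
    ∀ (N : ℕ) {f : R}, f ∈ 𝔭 ^ (N + 1) → A f ∈ 𝔭 ^ N := by
  intro N
  induction N with
  | zero => intro f _; simp
  | succ N ih =>
    intro f hf
    rw [pow_succ'] at hf
    refine Submodule.mul_induction_on hf (fun a ha b hb => ?_) (fun x y hx hy => ?_)
    · rw [Derivation.leibniz, smul_eq_mul, smul_eq_mul, pow_succ']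
      refine Ideal.add_mem _ (Ideal.mul_mem_mul ha (ih hb)) ?_
      have hb' : b ∈ 𝔭 * 𝔭 ^ N := by rw [← pow_succ']; exact hb
      exact Ideal.mul_mem_right _ _ hb'
    · rw [map_add]
      exact Ideal.add_mem _ hx hy

/-- Iterates: `A^n(𝔭^N) ⊆ 𝔭^{N-n}`. [folklore] -/
theorem iterate_derivation_mem_pow_sub (A : Derivation k R R) (𝔭 : Ideal R) (n : ℕ) :
    ∀ {N : ℕ} {f : R}, f ∈ 𝔭 ^ N → A^[n] f ∈ 𝔭 ^ (N - n) := by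
  induction n with
  | zero => intro N f hf; simpa using hf
  | succ n ih =>
    intro N f hf
    rw [Function.iterate_succ_apply']
    have h := ih hf
    rcases Nat.lt_or_ge n N with hlt | hge
    · obtain ⟨M, hM⟩ : ∃ M, N - n = M + 1 := ⟨N - n - 1, by omega⟩
      rw [hM] at h
      rw [show N - (n + 1) = M by omega]
      exact derivation_mem_pow_pred A 𝔭 M h
    · rw [show N - (n + 1) = 0 by omega, pow_zero, Ideal.one_eq_top]
      trivial

/-- The order `|μ| = ∑ μᵢ` of a multi-exponent. [folklore] -/
def order {s : ℕ} (μ : Fin s → ℕ) : ℕ := ∑ i, μ i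

/-- **Lemma A for `D^μ`**: `D^μ(𝔭^N) ⊆ 𝔭^{N - |μ|}`. [folklore] -/
theorem opPow_mem_pow_sub {s : ℕ} (D : Fin s → Derivation k R R) (𝔭 : Ideal R) :
    ∀ (μ : Fin s → ℕ) {N : ℕ} {f : R}, f ∈ 𝔭 ^ N → opPow D μ f ∈ 𝔭 ^ (N - order μ) := by
  induction s with
  | zero => intro μ N f hf; simpa [order] using hf
  | succ s ih =>
    intro μ N f hf
    rw [opPow_succ]
    have h := ih (Fin.tail D) (Fin.tail μ) hf
    have h2 := iterate_derivation_mem_pow_sub (D 0) 𝔭 (μ 0) h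
    have hord : order μ = μ 0 + order (Fin.tail μ) := by
      simp only [order, Fin.sum_univ_succ]; rfl
    rwa [hord, show N - (μ 0 + order (Fin.tail μ)) = N - order (Fin.tail μ) - μ 0 by omega]

/-- In particular `D^μ f ∈ 𝔭` for `f ∈ 𝔭^N` and `|μ| < N`. [folklore] -/
theorem opPow_mem_of_mem_pow {s : ℕ} (D : Fin s → Derivation k R R) {𝔭 : Ideal R}
    (μ : Fin s → ℕ) {N : ℕ} {f : R} (hf : f ∈ 𝔭 ^ N) (hN : order μ < N) : opPow D μ f ∈ 𝔭 := by
  have h := opPow_mem_pow_sub D 𝔭 μ hf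
  obtain ⟨M, hM⟩ : ∃ M, N - order μ = M + 1 := ⟨N - order μ - 1, by omega⟩
  rw [hM, pow_succ] at h
  exact Ideal.mul_le_left h

/-! ### Lemma B: `D^μ (a · g^κ)` modulo `𝔭` -/

/-- The power products `g^κ = ∏ gᵢ^{κᵢ}`. [folklore] -/
def gpow {s : ℕ} (g : Fin s → R) (κ : Fin s → ℕ) : R := ∏ i, g i ^ κ i

/-- `g^κ ∈ 𝔭^{|κ|}` when all `gᵢ ∈ 𝔭`. [folklore] -/
theorem gpow_mem_pow {s : ℕ} {g : Fin s → R} {𝔭 : Ideal R} (hg : ∀ i, g i ∈ 𝔭) (κ : Fin s → ℕ) :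
    gpow g κ ∈ 𝔭 ^ order κ := by
  classical
  unfold gpow order
  have key : ∀ t : Finset (Fin s), ∏ i ∈ t, g i ^ κ i ∈ 𝔭 ^ ∑ i ∈ t, κ i := by
    intro t
    induction t using Finset.induction_on with
    | empty => simp
    | insert a t ha ih =>
      rw [Finset.prod_insert ha, Finset.sum_insert ha, pow_add]
      exact Ideal.mul_mem_mul (Ideal.pow_mem_pow (hg a) _) ih
  exact key Finset.univ

/-- The unit `u_μ = ∏ μᵢ! (Dᵢ gᵢ)^{μᵢ}` of Lemma B. [folklore] -/
def lemmaBUnit {s : ℕ} (D : Fin s → Derivation k R R) (g : Fin s → R) (μ : Fin s → ℕ) : R :=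
  ∏ i, (((μ i).factorial : R) * D i (g i) ^ μ i)

/-- `u_μ ∉ 𝔭` when the `Dᵢ gᵢ ∉ 𝔭` (`𝔭` a prime of the `k`-algebra `R`, `char k = 0`). [folklore] -/
theorem lemmaBUnit_notMem [CharZero k] {s : ℕ} (D : Fin s → Derivation k R R) {g : Fin s → R}
    {𝔭 : Ideal R} (h𝔭 : 𝔭.IsPrime) (hdiag : ∀ i, D i (g i) ∉ 𝔭) (μ : Fin s → ℕ) :
    lemmaBUnit D g μ ∉ 𝔭 := by
  classical
  unfold lemmaBUnit
  refine (h𝔭.prod_mem_iff (s := Finset.univ)).not.mpr ?_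
  push Not
  intro i _ h
  rcases h𝔭.mem_or_mem h with h1 | h1
  · have hu : IsUnit (((μ i).factorial : R)) := by
      rw [← map_natCast (algebraMap k R)]
      exact (isUnit_iff_ne_zero.mpr (by exact_mod_cast (μ i).factorial_ne_zero)).map (algebraMap k R)
    exact h𝔭.ne_top (Ideal.eq_top_of_isUnit_mem _ h1 hu)
  · exact hdiag i (h𝔭.mem_of_pow_mem _ h1)

section LemmaB

variable {s : ℕ} {D : Fin s → Derivation k R R} {g : Fin s → R} {𝔭 : Ideal R}

/-- `∏_{j∈J} u_j^{κ_j} ∈ 𝔭^{∑_J κ_j}` when the `u_j ∈ 𝔭`, `j ∈ J` (any index type).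
[folklore] -/
theorem prod_pow_mem_pow_sum {ι' : Type*} {u : ι' → R} {J : Finset ι'} (hu : ∀ j ∈ J, u j ∈ 𝔭)
    (κ : ι' → ℕ) : ∏ j ∈ J, u j ^ κ j ∈ 𝔭 ^ ∑ j ∈ J, κ j := by
  classical
  induction J using Finset.induction_on with
  | empty => simp
  | insert a J ha ih =>
    rw [Finset.prod_insert ha, Finset.sum_insert ha, pow_add]
    exact Ideal.mul_mem_mul (Ideal.pow_mem_pow (hu a (Finset.mem_insert_self a J)) _)
      (ih fun j hj => hu j (Finset.mem_insert_of_mem hj))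

/-- **Lemma A'**: a derivation sending each `u_j`, `j ∈ J`, into `𝔭` sends `∏_{j ∈ J} u_j^{κ_j}`
(`u_j ∈ 𝔭`) into `𝔭^{∑_J κ_j}` — no loss of one power (any index type). [folklore] -/
theorem derivation_prod_pow_mem (A : Derivation k R R) {ι' : Type*} {u : ι' → R} {J : Finset ι'}
    (hu : ∀ j ∈ J, u j ∈ 𝔭) (hA : ∀ j ∈ J, A (u j) ∈ 𝔭) (κ : ι' → ℕ) :
    A (∏ j ∈ J, u j ^ κ j) ∈ 𝔭 ^ ∑ j ∈ J, κ j := by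
  classical
  induction J using Finset.induction_on with
  | empty => simp
  | insert a J ha ih =>
    rw [Finset.prod_insert ha, Finset.sum_insert ha, Derivation.leibniz, smul_eq_mul, smul_eq_mul,
      pow_add]
    have hu' : ∀ j ∈ J, u j ∈ 𝔭 := fun j hj => hu j (Finset.mem_insert_of_mem hj)
    have hA' : ∀ j ∈ J, A (u j) ∈ 𝔭 := fun j hj => hA j (Finset.mem_insert_of_mem hj)
    refine Ideal.add_mem _ (Ideal.mul_mem_mul (Ideal.pow_mem_pow (hu a (Finset.mem_insert_self a J)) _)
      (ih hu' hA')) ?_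
    rw [mul_comm (∏ j ∈ J, u j ^ κ j) (A (u a ^ κ a))]
    refine Ideal.mul_mem_mul ?_ (prod_pow_mem_pow_sum hu' κ)
    rw [Derivation.leibniz_pow]
    rcases Nat.eq_zero_or_pos (κ a) with h0 | hpos
    · simp [h0]
    · rw [nsmul_eq_mul, smul_eq_mul]
      refine Ideal.mul_mem_left _ _ ?_
      have : u a ^ (κ a - 1) * A (u a) ∈ 𝔭 ^ (κ a - 1 + 1) := by
        rw [pow_succ]
        exact Ideal.mul_mem_mul (Ideal.pow_mem_pow (hu a (Finset.mem_insert_self a J)) _)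
          (hA a (Finset.mem_insert_self a J))
      rwa [Nat.sub_add_cancel hpos] at this

/-- Splitting off the `i`-th factor of `g^κ`. [folklore] -/
theorem gpow_eq_mul_prod_erase (g : Fin s → R) (κ : Fin s → ℕ) (i : Fin s) :
    gpow g κ = g i ^ κ i * ∏ j ∈ Finset.univ.erase i, g j ^ κ j := by
  classical
  rw [gpow, ← Finset.mul_prod_erase Finset.univ (fun j => g j ^ κ j) (Finset.mem_univ i)]

/-- `g^{κ - eᵢ}` in split form (for `κᵢ ≥ 1`). [folklore] -/
theorem gpow_sub_single (g : Fin s → R) (κ : Fin s → ℕ) (i : Fin s) :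
    gpow g (κ - Pi.single i 1) = g i ^ (κ i - 1) * ∏ j ∈ Finset.univ.erase i, g j ^ κ j := by
  classical
  rw [gpow_eq_mul_prod_erase _ _ i, Pi.sub_apply, Pi.single_eq_same]
  congr 1
  refine Finset.prod_congr rfl fun j hj => ?_
  rw [Pi.sub_apply, Pi.single_apply, if_neg (Finset.ne_of_mem_erase hj), Nat.sub_zero]

/-- The derivative of `g^κ` in the direction `Dᵢ` modulo `𝔭^{|κ|}`:
`Dᵢ(g^κ) - κᵢ (Dᵢgᵢ) g^{κ - eᵢ} ∈ 𝔭^{|κ|}` (the factors `j ≠ i` pick up `Dᵢ g_j ∈ 𝔭`).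
[folklore] -/
theorem apply_gpow_sub_mem (hg : ∀ i, g i ∈ 𝔭) (hoff : ∀ i j, i ≠ j → D i (g j) ∈ 𝔭)
    (i : Fin s) (κ : Fin s → ℕ) :
    D i (gpow g κ) - (κ i : R) * D i (g i) * gpow g (κ - Pi.single i 1) ∈ 𝔭 ^ order κ := by
  classical
  rw [gpow_eq_mul_prod_erase g κ i, gpow_sub_single, Derivation.leibniz, smul_eq_mul, smul_eq_mul,
    Derivation.leibniz_pow, nsmul_eq_mul, smul_eq_mul]
  have hord : order κ = κ i + ∑ j ∈ Finset.univ.erase i, κ j := by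
    rw [order, ← Finset.add_sum_erase Finset.univ κ (Finset.mem_univ i)]
  have hrest : g i ^ κ i * D i (∏ j ∈ Finset.univ.erase i, g j ^ κ j) ∈ 𝔭 ^ order κ := by
    rw [hord, pow_add]
    exact Ideal.mul_mem_mul (Ideal.pow_mem_pow (hg i) _)
      (derivation_prod_pow_mem (D i) (fun j _ => hg j)
        (fun j hj => hoff i j (Finset.ne_of_mem_erase hj).symm) κ)
  have e : g i ^ κ i * D i (∏ j ∈ Finset.univ.erase i, g j ^ κ j) +
      (∏ j ∈ Finset.univ.erase i, g j ^ κ j) * ((κ i : R) * (g i ^ (κ i - 1) * D i (g i))) -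
      (κ i : R) * D i (g i) * (g i ^ (κ i - 1) * ∏ j ∈ Finset.univ.erase i, g j ^ κ j) =
      g i ^ κ i * D i (∏ j ∈ Finset.univ.erase i, g j ^ κ j) := by
    ring
  rw [e]
  exact hrest

/-- Peeling the `i`-th factor of the unit: `u_μ = μᵢ (Dᵢgᵢ) u_{μ - eᵢ}` for `μᵢ ≥ 1`. [folklore] -/
theorem lemmaBUnit_eq (D : Fin s → Derivation k R R) (g : Fin s → R) {μ : Fin s → ℕ} {i : Fin s}
    (hi : 1 ≤ μ i) :
    lemmaBUnit D g μ = (μ i : R) * D i (g i) * lemmaBUnit D g (μ - Pi.single i 1) := by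
  classical
  have split : ∀ ν : Fin s → ℕ, lemmaBUnit D g ν =
      (((ν i).factorial : R) * D i (g i) ^ ν i) *
        ∏ j ∈ Finset.univ.erase i, (((ν j).factorial : R) * D j (g j) ^ ν j) := fun ν => by
    unfold lemmaBUnit
    rw [Finset.mul_prod_erase Finset.univ (fun j => ((ν j).factorial : R) * D j (g j) ^ ν j)
      (Finset.mem_univ i)]
  rw [split μ, split (μ - Pi.single i 1)]
  have hj : ∀ j ∈ Finset.univ.erase i, (μ - Pi.single i 1 : Fin s → ℕ) j = μ j := fun j hj => by
    rw [Pi.sub_apply, Pi.single_apply, if_neg (Finset.ne_of_mem_erase hj), Nat.sub_zero]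
  have hprod : ∏ j ∈ Finset.univ.erase i, ((((μ - Pi.single i 1 : Fin s → ℕ) j).factorial : R) *
      D j (g j) ^ (μ - Pi.single i 1 : Fin s → ℕ) j) =
      ∏ j ∈ Finset.univ.erase i, (((μ j).factorial : R) * D j (g j) ^ μ j) :=
    Finset.prod_congr rfl fun j hj' => by rw [hj j hj']
  rw [hprod]
  have hii : (μ - Pi.single i 1 : Fin s → ℕ) i = μ i - 1 := by rw [Pi.sub_apply, Pi.single_eq_same]
  rw [hii]
  obtain ⟨m, hm⟩ : ∃ m, μ i = m + 1 := ⟨μ i - 1, by omega⟩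
  rw [hm, Nat.add_sub_cancel, Nat.factorial_succ, Nat.cast_mul, pow_succ]
  push_cast
  ring

/-- **Lemma B**: for pairwise commuting `Dᵢ` and `|κ| ≥ |μ|`,
`D^μ(a g^κ) ≡ [κ = μ] u_μ a (mod 𝔭)`. [cite: NesterenkoPhilippon2001, Ch. 11 Prop. 3.8 (Step 3)] -/
theorem opPow_mul_gpow_sub_mem (hD : ∀ i j (f : R), D i (D j f) = D j (D i f)) (hg : ∀ i, g i ∈ 𝔭)
    (hoff : ∀ i j, i ≠ j → D i (g j) ∈ 𝔭) :
    ∀ (m : ℕ) (μ : Fin s → ℕ), order μ = m → ∀ (a : R) (κ : Fin s → ℕ),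
      m ≤ order κ → opPow D μ (a * gpow g κ) - (if κ = μ then lemmaBUnit D g μ * a else 0) ∈ 𝔭 := by
  classical
  intro m
  induction m with
  | zero =>
    intro μ hμ a κ _
    have hμ0 : μ = 0 := by
      funext i
      have := (Finset.sum_eq_zero_iff.mp hμ) i (Finset.mem_univ i)
      simpa using this
    subst hμ0
    rw [opPow_zero_exponent]
    by_cases hκ : κ = 0
    · subst hκ
      simp [gpow, lemmaBUnit]
    · rw [if_neg hκ, sub_zero]
      have hpos : 0 < order κ := by
        by_contra h
        apply hκ
        funext i
        have := (Finset.sum_eq_zero_iff.mp (Nat.le_zero.mp (not_lt.mp h))) i (Finset.mem_univ i)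
        simpa using this
      have h := gpow_mem_pow (𝔭 := 𝔭) hg κ
      obtain ⟨M, hM⟩ : ∃ M, order κ = M + 1 := ⟨order κ - 1, by omega⟩
      rw [hM, pow_succ] at h
      exact Ideal.mul_mem_left _ a (Ideal.mul_le_left h)
  | succ m ih =>
    intro μ hμ a κ hκ
    obtain ⟨i, hi⟩ : ∃ i, 0 < μ i := by
      by_contra h
      push Not at h
      have : order μ = 0 := Finset.sum_eq_zero fun i _ => Nat.le_zero.mp (h i)
      omega
    set μ' := μ - Pi.single i 1 with hμ'
    have hμ'ord : order μ' = m := by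
      have h1 : order μ = μ i + ∑ j ∈ Finset.univ.erase i, μ j := by
        rw [order, ← Finset.add_sum_erase Finset.univ μ (Finset.mem_univ i)]
      have h2 : order μ' = μ' i + ∑ j ∈ Finset.univ.erase i, μ' j := by
        rw [order, ← Finset.add_sum_erase Finset.univ μ' (Finset.mem_univ i)]
      have h3 : ∑ j ∈ Finset.univ.erase i, μ' j = ∑ j ∈ Finset.univ.erase i, μ j :=
        Finset.sum_congr rfl fun j hj => by
          rw [hμ', Pi.sub_apply, Pi.single_apply, if_neg (Finset.ne_of_mem_erase hj), Nat.sub_zero]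
      have h4 : μ' i = μ i - 1 := by rw [hμ', Pi.sub_apply, Pi.single_eq_same]
      omega
    rw [opPow_sub_single D hD μ i hi, Derivation.leibniz, smul_eq_mul, smul_eq_mul]
    set E := D i (gpow g κ) - (κ i : R) * D i (g i) * gpow g (κ - Pi.single i 1) with hE
    have hEmem : E ∈ 𝔭 ^ order κ := apply_gpow_sub_mem hg hoff i κ
    have hsplit : a * D i (gpow g κ) + gpow g κ * D i a =
        D i a * gpow g κ + a * E + ((κ i : R) * D i (g i) * a) * gpow g (κ - Pi.single i 1) := by
      rw [hE]; ring
    rw [hsplit, opPow_add, opPow_add]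
    have h1 : opPow D μ' (D i a * gpow g κ) ∈ 𝔭 := by
      have h := ih μ' hμ'ord (D i a) κ (by omega)
      rwa [if_neg (by rintro rfl; omega), sub_zero] at h
    have h2 : opPow D μ' (a * E) ∈ 𝔭 :=
      opPow_mem_of_mem_pow D μ' (Ideal.mul_mem_left _ a hEmem) (by omega)
    have h3 : opPow D μ' (((κ i : R) * D i (g i) * a) * gpow g (κ - Pi.single i 1)) -
        (if κ = μ then lemmaBUnit D g μ * a else 0) ∈ 𝔭 := by
      rcases Nat.eq_zero_or_pos (κ i) with hκ0 | hκpos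
      · have hne : κ ≠ μ := by rintro rfl; omega
        rw [if_neg hne, hκ0, Nat.cast_zero, zero_mul, zero_mul, zero_mul, sub_zero, opPow_map_zero]
        exact Ideal.zero_mem _
      · have hord' : m ≤ order (κ - Pi.single i 1) := by
          have e1 : order (κ - Pi.single i 1) + 1 = order κ := by
            have h1 : order κ = κ i + ∑ j ∈ Finset.univ.erase i, κ j := by
              rw [order, ← Finset.add_sum_erase Finset.univ κ (Finset.mem_univ i)]
            have h2 : order (κ - Pi.single i 1) = (κ - Pi.single i 1 : Fin s → ℕ) i +
                ∑ j ∈ Finset.univ.erase i, (κ - Pi.single i 1 : Fin s → ℕ) j := by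
              rw [order, ← Finset.add_sum_erase Finset.univ (κ - Pi.single i 1) (Finset.mem_univ i)]
            have h3 : ∑ j ∈ Finset.univ.erase i, (κ - Pi.single i 1 : Fin s → ℕ) j =
                ∑ j ∈ Finset.univ.erase i, κ j :=
              Finset.sum_congr rfl fun j hj => by
                rw [Pi.sub_apply, Pi.single_apply, if_neg (Finset.ne_of_mem_erase hj), Nat.sub_zero]
            have h4 : (κ - Pi.single i 1 : Fin s → ℕ) i = κ i - 1 := by
              rw [Pi.sub_apply, Pi.single_eq_same]
            omega
          omega
        have h := ih μ' hμ'ord ((κ i : R) * D i (g i) * a) (κ - Pi.single i 1) hord'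
        have hiff : (κ - Pi.single i 1 = μ') ↔ (κ = μ) := by
          constructor
          · intro heq
            funext j
            have hj := congrFun heq j
            by_cases hji : j = i
            · subst hji
              rw [Pi.sub_apply, Pi.single_eq_same, hμ', Pi.sub_apply, Pi.single_eq_same] at hj
              omega
            · rwa [Pi.sub_apply, Pi.single_apply, if_neg hji, hμ', Pi.sub_apply, Pi.single_apply,
                if_neg hji, Nat.sub_zero, Nat.sub_zero] at hj
          · rintro rfl; rfl
        by_cases hκμ : κ = μ
        · rw [if_pos hκμ]
          rw [if_pos (hiff.mpr hκμ)] at h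
          have hu : lemmaBUnit D g μ' * ((κ i : R) * D i (g i) * a) = lemmaBUnit D g μ * a := by
            rw [hκμ, lemmaBUnit_eq D g (i := i) hi, hμ']; ring
          rwa [hu] at h
        · rw [if_neg hκμ]
          rwa [if_neg (fun h' => hκμ (hiff.mp h'))] at h
    have e : opPow D μ' (D i a * gpow g κ) + opPow D μ' (a * E) +
        opPow D μ' ((κ i : R) * D i (g i) * a * gpow g (κ - Pi.single i 1)) -
        (if κ = μ then lemmaBUnit D g μ * a else 0) =
        opPow D μ' (D i a * gpow g κ) + opPow D μ' (a * E) +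
        (opPow D μ' ((κ i : R) * D i (g i) * a * gpow g (κ - Pi.single i 1)) -
          (if κ = μ then lemmaBUnit D g μ * a else 0)) := by ring
    rw [e]
    exact Ideal.add_mem _ (Ideal.add_mem _ h1 h2) h3

end LemmaB

/-! ### Step 3: linear independence of the `F_l g^κ` modulo `𝔮` -/

section Step3

variable {s : ℕ} {D : Fin s → Derivation k R R} {g : Fin s → R} {𝔭 𝔮 : Ideal R}

/-- **Wüstholz's multiplicity lemma, Step 3 of Roy's proof of Prop. 3.8.** Let `D₁, …, D_s` be
pairwise commuting `k`-derivations of the commutative `k`-algebra `R` (`char k = 0`), `𝔭` a prime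
ideal, `g₁, …, g_s ∈ 𝔭` with `Dᵢ g_j ∈ 𝔭` for `i ≠ j` and `Dᵢ gᵢ ∉ 𝔭` (transversal equations),
and `𝔮` an ideal all of whose members are sent into `𝔭` by the `D^μ`, `|μ| ≤ T`. If `(F_l)` is a
finite family linearly independent modulo `𝔭` and `K` a finite set of multi-indices of order
`≤ T`, then a `k`-combination `∑ c_{l,κ} F_l g^κ ∈ 𝔮` has all its coefficients `c_{l,κ}`,
`κ ∈ K`, equal to zero — so the `binom(T+s, s) · N` products `F_l g^κ`, `|κ| ≤ T`, are linearly
independent modulo `𝔮`. [cite: NesterenkoPhilippon2001, Ch. 11 Prop. 3.8 (Step 3, (96)–(97))] -/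
theorem coeff_eq_zero_of_sum_mem [CharZero k] (hD : ∀ i j (f : R), D i (D j f) = D j (D i f))
    (h𝔭 : 𝔭.IsPrime) (hg : ∀ i, g i ∈ 𝔭)
    (hoff : ∀ i j, i ≠ j → D i (g j) ∈ 𝔭) (hdiag : ∀ i, D i (g i) ∉ 𝔭)
    {T : ℕ} (H𝔮 : ∀ f ∈ 𝔮, ∀ μ : Fin s → ℕ, order μ ≤ T → opPow D μ f ∈ 𝔭)
    (K : Finset (Fin s → ℕ)) (hK : ∀ κ ∈ K, order κ ≤ T)
    {ι : Type*} [Fintype ι] {F : ι → R}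
    (hF : ∀ c : ι → k, (∑ l, c l • F l) ∈ 𝔭 → ∀ l, c l = 0)
    (c : ι → (Fin s → ℕ) → k) (hc : (∑ l, ∑ κ ∈ K, c l κ • (F l * gpow g κ)) ∈ 𝔮) :
    ∀ l, ∀ κ ∈ K, c l κ = 0 := by
  classical
  suffices H : ∀ m, ∀ l, ∀ κ ∈ K, order κ < m → c l κ = 0 from
    fun l κ hκ => H (order κ + 1) l κ hκ (Nat.lt_succ_self _)
  intro m
  induction m with
  | zero => intro l κ _ h; exact absurd h (Nat.not_lt_zero _)
  | succ m ih =>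
    intro l₀ μ hμK hμm
    rcases Nat.lt_or_ge (order μ) m with hlt | hge
    · exact ih l₀ μ hμK hlt
    have hμ : order μ = m := by omega
    have h1 : opPow D μ (∑ l, ∑ κ ∈ K, c l κ • (F l * gpow g κ)) ∈ 𝔭 := H𝔮 _ hc μ (hK μ hμK)
    set r : ι → (Fin s → ℕ) → R := fun l κ =>
      opPow D μ (F l * gpow g κ) - (if κ = μ then lemmaBUnit D g μ * F l else 0) with hr
    have hexp : opPow D μ (∑ l, ∑ κ ∈ K, c l κ • (F l * gpow g κ)) =
        lemmaBUnit D g μ * (∑ l, c l μ • F l) + ∑ l, ∑ κ ∈ K, c l κ • r l κ := by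
      rw [opPow_sum]
      simp_rw [opPow_sum, opPow_smul]
      have hterm : ∀ l κ, c l κ • opPow D μ (F l * gpow g κ) =
          c l κ • (if κ = μ then lemmaBUnit D g μ * F l else 0) + c l κ • r l κ := by
        intro l κ; rw [hr]; simp only; rw [← smul_add, add_sub_cancel]
      simp_rw [hterm, Finset.sum_add_distrib]
      congr 1
      rw [Finset.mul_sum]
      refine Finset.sum_congr rfl fun l _ => ?_
      have hite : ∀ κ ∈ K, c l κ • (if κ = μ then lemmaBUnit D g μ * F l else 0) =
          if κ = μ then c l μ • (lemmaBUnit D g μ * F l) else 0 := fun κ _ => by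
        split_ifs with h <;> simp [h]
      rw [Finset.sum_congr rfl hite, Finset.sum_ite_eq', if_pos hμK, mul_smul_comm]
    have h2 : (∑ l, ∑ κ ∈ K, c l κ • r l κ) ∈ 𝔭 := by
      refine Ideal.sum_mem _ fun l _ => Ideal.sum_mem _ fun κ hκ => ?_
      rcases Nat.lt_or_ge (order κ) m with hlt | hge'
      · rw [ih l κ hκ hlt, zero_smul]; exact Ideal.zero_mem _
      · rw [Algebra.smul_def]
        exact Ideal.mul_mem_left _ _ (opPow_mul_gpow_sub_mem hD hg hoff m μ hμ (F l) κ hge')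
    rw [hexp] at h1
    have h3 : lemmaBUnit D g μ * (∑ l, c l μ • F l) ∈ 𝔭 := by
      have := Ideal.sub_mem _ h1 h2
      rwa [add_sub_cancel_right] at this
    rcases h𝔭.mem_or_mem h3 with h4 | h4
    · exact absurd h4 (lemmaBUnit_notMem D h𝔭 hdiag μ)
    · exact hF (fun l => c l μ) h4 l₀

end Step3

/-! ### The count: `#K · dim(V/V ∩ 𝔭) ≤ dim(W/W ∩ 𝔮)` -/

section Count

variable {s : ℕ} {D : Fin s → Derivation k R R} {g : Fin s → R} {𝔭 𝔮 : Ideal R}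

/-- **The count** (Roy's (95), `H(𝔮; D + dT) ≥ binom(T+s, s)·H(𝔭; D)`, in filtration-free form).
In the situation of `coeff_eq_zero_of_sum_mem`, let `V, W` be finite-dimensional `k`-subspaces of
`R` (think: forms of degree `D` and of degree `D + dT`) with `V · g^κ ⊆ W` for `κ ∈ K`. Then
`#K · dim_k (V / V ∩ 𝔭) ≤ dim_k (W / W ∩ 𝔮)`. [cite: NesterenkoPhilippon2001, Ch. 11 Prop. 3.8 (95)] -/
theorem card_mul_finrank_quotient_le [CharZero k] (hD : ∀ i j (f : R), D i (D j f) = D j (D i f))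
    (h𝔭 : 𝔭.IsPrime) (hg : ∀ i, g i ∈ 𝔭)
    (hoff : ∀ i j, i ≠ j → D i (g j) ∈ 𝔭) (hdiag : ∀ i, D i (g i) ∉ 𝔭)
    {T : ℕ} (H𝔮 : ∀ f ∈ 𝔮, ∀ μ : Fin s → ℕ, order μ ≤ T → opPow D μ f ∈ 𝔭)
    (K : Finset (Fin s → ℕ)) (hK : ∀ κ ∈ K, order κ ≤ T)
    (V W : Submodule k R) [FiniteDimensional k V] [FiniteDimensional k W]
    (hVW : ∀ κ ∈ K, ∀ v ∈ V, v * gpow g κ ∈ W) :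
    K.card * Module.finrank k (↥V ⧸ (𝔭.restrictScalars k).comap V.subtype) ≤
      Module.finrank k (↥W ⧸ (𝔮.restrictScalars k).comap W.subtype) := by
  classical
  set U : Submodule k ↥V := (𝔭.restrictScalars k).comap V.subtype with hU
  set U' : Submodule k ↥W := (𝔮.restrictScalars k).comap W.subtype with hU'
  set b := Module.finBasis k (↥V ⧸ U) with hb
  set N := Module.finrank k (↥V ⧸ U) with hN
  -- lifts of the basis vectors, linearly independent modulo `𝔭`
  choose F hF using fun l => Submodule.Quotient.mk_surjective U (b l)
  have hFind : ∀ d : Fin N → k, (∑ l, d l • (F l : R)) ∈ 𝔭 → ∀ l, d l = 0 := by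
    intro d hd
    have hmem : (∑ l, d l • F l : ↥V) ∈ U := by
      simp only [hU, Submodule.mem_comap, Submodule.coe_subtype, Submodule.restrictScalars_mem,
        Submodule.coe_sum, Submodule.coe_smul]
      exact hd
    have h0 : (∑ l, d l • b l : ↥V ⧸ U) = 0 := by
      have h := (Submodule.Quotient.mk_eq_zero U).mpr hmem
      rw [← Submodule.mkQ_apply, map_sum] at h
      simp_rw [map_smul, Submodule.mkQ_apply, hF] at h
      exact h
    exact fun l => Fintype.linearIndependent_iff.mp b.linearIndependent d h0 l
  -- the family `Φ (l, κ) = F_l g^κ ∈ W`, linearly independent modulo `𝔮`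
  have hΦmem : ∀ p : Fin N × ↥K, (F p.1 : R) * gpow g p.2.1 ∈ W := fun p => hVW p.2.1 p.2.2 _ (F p.1).2
  set Φ : Fin N × ↥K → ↥W ⧸ U' := fun p => Submodule.Quotient.mk ⟨(F p.1 : R) * gpow g p.2.1, hΦmem p⟩
    with hΦ
  have hli : LinearIndependent k Φ := by
    rw [Fintype.linearIndependent_iff]
    intro d hd p
    have hmem : (∑ q, d q • (⟨(F q.1 : R) * gpow g q.2.1, hΦmem q⟩ : ↥W)) ∈ U' := by
      rw [← Submodule.Quotient.mk_eq_zero, ← Submodule.mkQ_apply, map_sum]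
      simp_rw [map_smul, Submodule.mkQ_apply]
      exact hd
    simp only [hU', Submodule.mem_comap, Submodule.coe_subtype, Submodule.restrictScalars_mem,
      Submodule.coe_sum, Submodule.coe_smul] at hmem
    have key := coeff_eq_zero_of_sum_mem hD h𝔭 hg hoff hdiag H𝔮 K hK hFind
      (fun l κ => if h : κ ∈ K then d (l, ⟨κ, h⟩) else 0) ?_ p.1 p.2.1 p.2.2
    · simpa using key
    · have e : (∑ l, ∑ κ ∈ K, (if h : κ ∈ K then d (l, ⟨κ, h⟩) else 0) • ((F l : R) * gpow g κ)) =
          ∑ q : Fin N × ↥K, d q • ((F q.1 : R) * gpow g q.2.1) := by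
        rw [Fintype.sum_prod_type]
        refine Finset.sum_congr rfl fun l _ => ?_
        rw [← Finset.sum_coe_sort K]
        refine Finset.sum_congr rfl fun κ _ => ?_
        rw [dif_pos κ.2]
      rw [e]
      exact hmem
  have := hli.fintype_card_le_finrank
  rwa [Fintype.card_prod, Fintype.card_fin, Fintype.card_coe, mul_comm] at this

end Count

end MultiplicityLemma

end Literature.NumberTheory.Transcendental
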